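import Summits.BirchSwinnertonDyer.BirchSwinnertonDyer.Theorems.ThetaPartnerAtTwoSignedKatoUpToAtTwoPointsModelJ
import Literature.NumberTheory.EllipticCurves.NeronOggShafarevichLocal
import Literature.NumberTheory.EllipticCurves.IwasawaSelmerSupersingularLocalProofs
import Mathlib.Algebra.Module.CharacterModule
import Mathlib.LinearAlgebra.LinearPMap
import Mathlib.NumberTheory.Padics.RingHoms
import HarnessLib

/-!
# Route `ThetaPartnerAtTwo` (TP2), crux K3 `SignedKatoDivisibilityUpToAtTwo` (item stmt-BirchSwinnertonDyer-20308),
# line `colemanrat` v4 — CHARACTERS ARE KUMMER VALUES: **every character of a subgroup `S ≤ H¹(K_∞, E[p^∞])` that kills the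
# classes with a torsion Kummer witness is, on the Kummer-from-`A` classes of `S`, the Kummer-value character of a `ℤ_p`-valued
# functional on the local tower points `E(K_∞·K_v)`** (the converse of the width seat's `KummerPoint.exists_kummerCharacter`;
# sequel `…PointsLocalCover.lean` = the hard half of the local cover on a pinned dual).

Lead `bsd-wall-tp2-p2x` g4 (cell `bsd-wall`). HONEST FRAMING: THEOREMS ONLY — no definition, no named fact, no instance, no
`sorry`; route-independent; CONVENTION-FREE (one side of Poitou–Tate only, cf. `Cruxes/…/G4-CONVENTION-AUDIT.md`);
closes no item; BSD is NOT proved by any of this.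

## What is proved

* §1 `exists_zmod_val_smul_invPow_eq`, `zmod_eq_of_val_smul_invPow_eq` — the `p^k`-torsion of `ℚ/ℤ = AddCircle (1 : ℚ)` is
  `{n • (1/p^k) : n ∈ ℤ/p^k}`, faithfully.
* §2 `exists_padicInt_toZModPow_eq` — a family `N_k ∈ ℤ/p^k` with `N_{k+1} ≡ N_k (mod p^k)` is `(x mod p^k)_k` for one
  `x ∈ ℤ_p` (`PadicInt.ofIntSeq`).
* §3 `exists_functional_of_kummerCharacter` — the CONVERSE of w3's `exists_kummerCharacter`: for `A ≤ E(K_∞·K_v)`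
  `p`-saturated in the tower (any `K` of characteristic `0`, `W` elliptic, `p`, `κ`, `ι`) and a character `χ` of the
  Kummer-from-`A` classes `Kummer(A) ≤ H¹(K_∞, E[p^∞])` vanishing on every class with a TORSION witness, there is a
  functional `z : E(K_∞·K_v) →+ ℤ_p` with `χ c = (z(p^k Q) mod p^k) • (1/p^k)` for EVERY Kummer witness `(φ, Q, k)` of `c`.
  Construction: `χ` descends to the witness points `Q` (two classes with the same witness point differ by a class with the
  witness `0`), vanishes on `E(K_∞·K_v) + ι(E[p^∞])` there, extends — first along the sup with that subgroup (`LinearPMap.sup`),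
  then to all of `E(K̄_v)` by the injectivity of `ℚ/ℤ` (`CharacterModule.dual_surjective_of_injective`) — to a character
  `χ̃` of `E(K̄_v)` killing `E(K_∞·K_v) + ι(E[p^∞])`; and `z(P) := (p^k · χ̃(Q_k))_k`, `p^k Q_k = P` (divisibility of
  `E(K̄_v)`), is a well-defined (roots differ by torsion = `ι`(torsion)) additive `ℤ_p`-valued functional.
* Sequel `…PointsLocalCover.lean`: the same on a pinned `SignedSelmerDualData` at a place `v ∋ p` — the (LocCover) clause of K3's
  registered stub `stub_localRobustPackageTwo` in the points model, exponent `m = 0`.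

References: [Kobayashi2003] §2 p. 4 (Kummer map), (7.17) (p. 12); [GreenbergLNM1716] §2; [SilvermanAEC2009] VIII §2, X §4;
[SerreGaloisCohomology1997] I §5.1.
-/

set_option autoImplicit false
-- the Theorems namespace of this sub repeats the summit name by design (D-0017 nested layout)
set_option linter.dupNamespace false

noncomputable section

open scoped Classical

namespace Summit.BirchSwinnertonDyer.BirchSwinnertonDyer.Theorems

namespace SignedKatoOffTwo.KummerPoint

open NumberField IsDedekindDomain Field WeierstrassCurve
  Literature.NumberTheory.EllipticCurves Literature.NumberTheory.EllipticCurves.Kobayashi2003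
  Literature.NumberTheory.EllipticCurves.GreenbergSelmer
  Literature.NumberTheory.EllipticCurves.Sprung2012 Literature.NumberTheory.GaloisRepresentations ZpExtension

universe u

/-! ## §1 The `p^k`-torsion of `ℚ/ℤ` -/

section Values

variable (p : ℕ) [Fact p.Prime]

/-- `1/p^k ∈ ℚ/ℤ` has additive order `p^k`. [folklore] -/
theorem addOrderOf_invPow (k : ℕ) :
    addOrderOf ((((p : ℚ) ^ k)⁻¹ : ℚ) : AddCircle (1 : ℚ)) = p ^ k := by
  have hpos : 0 < p ^ k := pow_pos (Fact.out : p.Prime).pos k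
  have h := AddCircle.addOrderOf_div_of_gcd_eq_one (p := (1 : ℚ)) (m := 1) hpos (Nat.gcd_one_left _)
  simpa [one_div] using h

/-- A multiple `m • (1/p^k)` vanishes only if `p^k ∣ m`. [folklore] -/
theorem pow_dvd_of_nsmul_invPow_eq_zero {k m : ℕ}
    (h : m • ((((p : ℚ) ^ k)⁻¹ : ℚ) : AddCircle (1 : ℚ)) = 0) : p ^ k ∣ m := by
  rw [← addOrderOf_invPow p k]
  exact addOrderOf_dvd_of_nsmul_eq_zero h

/-- **Every `p^k`-torsion element of `ℚ/ℤ` is `n • (1/p^k)` for some `n ∈ ℤ/p^k`.** [folklore] -/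
theorem exists_zmod_val_smul_invPow_eq (k : ℕ) (a : AddCircle (1 : ℚ)) (ha : p ^ k • a = 0) :
    ∃ n : ZMod (p ^ k), a = n.val • ((((p : ℚ) ^ k)⁻¹ : ℚ) : AddCircle (1 : ℚ)) := by
  haveI : NeZero (p ^ k) := ⟨pow_ne_zero k (Fact.out : p.Prime).ne_zero⟩
  have hp : ((p : ℚ) ^ k) ≠ 0 := pow_ne_zero k (Nat.cast_ne_zero.2 (Fact.out : p.Prime).ne_zero)
  obtain ⟨q, rfl⟩ := QuotientAddGroup.mk_surjective a
  change p ^ k • ((q : ℚ) : AddCircle (1 : ℚ)) = 0 at ha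
  rw [← AddCircle.coe_nsmul, AddCircle.coe_eq_zero_iff] at ha
  obtain ⟨m, hm⟩ := ha
  rw [zsmul_eq_mul, mul_one, nsmul_eq_mul] at hm
  -- `q = m / p^k`
  have hq : q = (m : ℚ) * ((p : ℚ) ^ k)⁻¹ := by
    rw [eq_mul_inv_iff_mul_eq₀ hp, mul_comm]; exact_mod_cast hm.symm
  refine ⟨(m : ZMod (p ^ k)), ?_⟩
  change ((q : ℚ) : AddCircle (1 : ℚ)) = _
  -- `m • (1/p^k) = (m mod p^k) • (1/p^k)`
  have hval : ((m : ZMod (p ^ k)).val : ℤ) = m % (p ^ k : ℕ) := ZMod.val_intCast m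
  have hx0 : (p ^ k : ℤ) • ((((p : ℚ) ^ k)⁻¹ : ℚ) : AddCircle (1 : ℚ)) = 0 := by
    rw [show (p ^ k : ℤ) = ((p ^ k : ℕ) : ℤ) by push_cast; rfl, natCast_zsmul]
    exact pow_nsmul_invPow_self p k
  calc ((q : ℚ) : AddCircle (1 : ℚ))
      = (m : ℤ) • ((((p : ℚ) ^ k)⁻¹ : ℚ) : AddCircle (1 : ℚ)) := by
        rw [hq, ← AddCircle.coe_zsmul, zsmul_eq_mul]
    _ = ((m % (p ^ k : ℕ) + (p ^ k : ℕ) * (m / (p ^ k : ℕ)) : ℤ)) • ((((p : ℚ) ^ k)⁻¹ : ℚ) : AddCircle (1 : ℚ)) := by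
        rw [Int.emod_add_mul_ediv]
    _ = ((m : ZMod (p ^ k)).val : ℤ) • ((((p : ℚ) ^ k)⁻¹ : ℚ) : AddCircle (1 : ℚ)) := by
        rw [add_zsmul, mul_comm, mul_zsmul, Nat.cast_pow, hx0, smul_zero, add_zero, hval, Nat.cast_pow]
    _ = (m : ZMod (p ^ k)).val • ((((p : ℚ) ^ k)⁻¹ : ℚ) : AddCircle (1 : ℚ)) := natCast_zsmul _ _

/-- **Faithfulness**: `n • (1/p^k) = n' • (1/p^k)` in `ℚ/ℤ` for `n, n' ∈ ℤ/p^k` forces `n = n'`. [folklore] -/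
theorem zmod_eq_of_val_smul_invPow_eq {k : ℕ} {n n' : ZMod (p ^ k)}
    (h : n.val • ((((p : ℚ) ^ k)⁻¹ : ℚ) : AddCircle (1 : ℚ)) = n'.val • ((((p : ℚ) ^ k)⁻¹ : ℚ) : AddCircle (1 : ℚ))) :
    n = n' := by
  haveI : NeZero (p ^ k) := ⟨pow_ne_zero k (Fact.out : p.Prime).ne_zero⟩
  wlog hle : n.val ≤ n'.val generalizing n n'
  · exact (this h.symm (le_of_not_ge hle)).symm
  have h0 : (n'.val - n.val) • ((((p : ℚ) ^ k)⁻¹ : ℚ) : AddCircle (1 : ℚ)) = 0 := by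
    rw [sub_nsmul _ hle, ← h, add_neg_cancel]
  have hdvd := pow_dvd_of_nsmul_invPow_eq_zero p h0
  have hlt : n'.val - n.val < p ^ k := lt_of_le_of_lt (Nat.sub_le _ _) (ZMod.val_lt n')
  have hzero : n'.val - n.val = 0 := Nat.eq_zero_of_dvd_of_lt hdvd hlt
  exact ZMod.val_injective _ (by omega)

end Values

/-! ## §2 Compatible residues assemble to a `p`-adic integer -/

section Padic

variable (p : ℕ) [Fact p.Prime]

/-- **`ℤ_p = lim ℤ/p^k` for additive data**: a family `N : ∀ k, ℤ/p^k` with `N (k+1) ≡ N k (mod p^k)` is the family of residues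
of one `x ∈ ℤ_p` (Mathlib's `PadicInt.ofIntSeq` on the integer lifts). [folklore] -/
theorem exists_padicInt_toZModPow_eq (N : ∀ k : ℕ, ZMod (p ^ k))
    (hN : ∀ k, ZMod.castHom (pow_dvd_pow p (Nat.le_succ k)) (ZMod (p ^ k)) (N (k + 1)) = N k) :
    ∃ x : ℤ_[p], ∀ k, PadicInt.toZModPow k x = N k := by
  let f : ℕ → ℤ := fun k ↦ ((N k).val : ℤ)
  have hf : ∀ i, (p : ℤ) ^ i ∣ f (i + 1) - f i := by
    intro i
    haveI : NeZero (p ^ i) := ⟨pow_ne_zero i (Fact.out : p.Prime).ne_zero⟩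
    haveI : NeZero (p ^ (i + 1)) := ⟨pow_ne_zero (i + 1) (Fact.out : p.Prime).ne_zero⟩
    have h1 : ((f (i + 1) : ℤ) : ZMod (p ^ i)) = ((f i : ℤ) : ZMod (p ^ i)) := by
      have h2 : (ZMod.cast (N (i + 1)) : ZMod (p ^ i)) = N i := by
        simpa only [ZMod.castHom_apply] using hN i
      simp only [f, Int.cast_natCast]
      rw [ZMod.natCast_val, ZMod.natCast_zmod_val, h2]
    rw [← Nat.cast_pow]
    exact (ZMod.intCast_eq_intCast_iff_dvd_sub _ _ _).1 h1.symm
  refine ⟨PadicInt.ofIntSeq f (PadicInt.isCauSeq_padicNorm_of_pow_dvd_sub f p hf), fun k ↦ ?_⟩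
  haveI : NeZero (p ^ k) := ⟨pow_ne_zero k (Fact.out : p.Prime).ne_zero⟩
  rw [PadicInt.toZModPow_ofIntSeq_of_pow_dvd_sub f p hf k]
  simp only [f, Int.cast_natCast, ZMod.natCast_zmod_val]

end Padic

/-! ## §3 Characters of the Kummer-from-`A` classes killing the torsion-witness classes are Kummer values -/

section Functional

variable {K : Type u} [Field K] [CharZero K] (W : WeierstrassCurve K) [W.IsElliptic] (p : ℕ) [Fact p.Prime]
  (κ : ZpExtension K p) {E : Type u} [Field E] [Algebra K E] (ι : AlgebraicClosure K →ₐ[K] AlgebraicClosure E)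

/-- Two `p^k`-th roots of the same point differ by the image of a `p`-primary torsion point of `E(K̄)`.
[cite: SilvermanAEC2009, Cor. III.6.4(b)] -/
theorem exists_torsion_of_pow_nsmul_eq {k : ℕ} {Q Q' P : localPoints W E} (hQ : p ^ k • Q = P) (hQ' : p ^ k • Q' = P) :
    ∃ t : W.geomPrimaryTorsion p, Q' = Q + pointsMapOfEmb W ι (t : W.geomPoints) := by
  have h0 : p ^ k • (Q' - Q) = 0 := by rw [smul_sub, hQ, hQ', sub_self]
  obtain ⟨P₀, hP₀, hP₀Q⟩ := exists_pointsMapOfEmb_eq_of_nsmul_eq_zero W ι (pow_ne_zero k (Fact.out : p.Prime).ne_zero) h0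
  have hmem : P₀ ∈ W.geomPrimaryTorsion p := (AddCommGroup.mem_primaryComponent (G := W.geomPoints)).2 ⟨k, hP₀⟩
  exact ⟨⟨P₀, hmem⟩, by rw [hP₀Q]; abel⟩

/-- **A character `χ` of a subgroup `S ≤ H¹(K_∞, E[p^∞])` that kills every class of `S` with a TORSION Kummer witness is, on the
classes of `S` that are Kummer-from-`A`, the Kummer-value character of a `ℤ_p`-valued functional on the tower points** (converse of
`exists_kummerCharacter`; `A ≤ E(K_∞·K_v)` arbitrary, no saturation needed in this direction): there is `z : E(K_∞·K_v) →+ ℤ_p` with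
`χ c = (z(p^k Q) mod p^k) • (1/p^k)` for EVERY `c ∈ S` and EVERY Kummer witness `(φ, Q, k)` of `c` relative to `A`. See the module docstring for the construction (divisibility of `ℚ/ℤ` twice, divisibility of `E(K̄_v)`, all torsion
of `E(K̄_v)` is `ι`(torsion)). [cite: Kobayashi2003, §2 p. 4, (7.17) (p. 12)] [cite: GreenbergLNM1716, §2] [cite: SilvermanAEC2009, VIII §2, X §4] -/
theorem exists_functional_of_kummerCharacter (A : AddSubgroup (localPoints W E)) (hA : A ≤ localTowerPointsOfEmb κ ι W)
    (S : AddSubgroup (W.subgroupH1 p κ.kerSubgroup)) (χ : S →+ AddCircle (1 : ℚ))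
    (hχ : ∀ (c : S)
      (φ : contOneCocycles (discreteTopRep κ.kerSubgroup (W.geomPrimaryTorsion p))) (t : W.geomPrimaryTorsion p),
      oneCocycleClass _ φ = (c : W.subgroupH1 p κ.kerSubgroup) →
      (∀ τ : localSubgroupOfEmb κ.kerSubgroup ι,
        pointsMapOfEmb W ι ((φ.1 (resGalSubgroupOfEmb κ.kerSubgroup ι τ) : W.geomPrimaryTorsion p) : W.geomPoints) =
          (τ : Field.absoluteGaloisGroup E) • pointsMapOfEmb W ι (t : W.geomPoints) - pointsMapOfEmb W ι (t : W.geomPoints)) →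
      χ c = 0) :
    ∃ z : localTowerPointsOfEmb κ ι W →+ ℤ_[p],
      ∀ (c : S)
        (φ : contOneCocycles (discreteTopRep κ.kerSubgroup (W.geomPrimaryTorsion p))) (Q : localPoints W E) (k : ℕ)
        (_ : oneCocycleClass _ φ = (c : W.subgroupH1 p κ.kerSubgroup)) (hQ : p ^ k • Q ∈ A)
        (_ : ∀ τ : localSubgroupOfEmb κ.kerSubgroup ι,
          pointsMapOfEmb W ι ((φ.1 (resGalSubgroupOfEmb κ.kerSubgroup ι τ) : W.geomPrimaryTorsion p) : W.geomPoints) =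
            (τ : Field.absoluteGaloisGroup E) • Q - Q),
        χ c = (PadicInt.toZModPow k (z ⟨p ^ k • Q, hA hQ⟩)).val • ((((p : ℚ) ^ k)⁻¹ : ℚ) : AddCircle (1 : ℚ)) := by
  -- notation
  set T : AddSubgroup (localPoints W E) := localTowerPointsOfEmb κ ι W with hT
  set Tι : AddSubgroup (localPoints W E) := (W.geomPrimaryTorsion p).map (pointsMapOfEmb W ι) with hTι
  set N : AddSubgroup (localPoints W E) := T ⊔ Tι with hN
  -- the witness predicate (local half)
  let IsW : contOneCocycles (discreteTopRep κ.kerSubgroup (W.geomPrimaryTorsion p)) → localPoints W E → Prop :=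
    fun φ Q ↦ ∀ τ : localSubgroupOfEmb κ.kerSubgroup ι,
      pointsMapOfEmb W ι ((φ.1 (resGalSubgroupOfEmb κ.kerSubgroup ι τ) : W.geomPrimaryTorsion p) : W.geomPoints) =
        (τ : Field.absoluteGaloisGroup E) • Q - Q
  have isW_add : ∀ {φ φ' Q Q'}, IsW φ Q → IsW φ' Q' → IsW (φ + φ') (Q + Q') := fun {φ φ' Q Q'} h h' τ ↦ by
    rw [Submodule.coe_add, ContinuousMap.add_apply, AddSubgroup.coe_add, map_add, h τ, h' τ, smul_add]
    abel
  have isW_neg : ∀ {φ Q}, IsW φ Q → IsW (-φ) (-Q) := fun {φ Q} h τ ↦ by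
    rw [Submodule.coe_neg, ContinuousMap.neg_apply, AddSubgroup.coe_neg, map_neg, h τ, smul_neg]
    abel
  have isW_sub : ∀ {φ φ' Q Q'}, IsW φ Q → IsW φ' Q' → IsW (φ - φ') (Q - Q') := fun {φ φ' Q Q'} h h' ↦ by
    rw [sub_eq_add_neg, sub_eq_add_neg]; exact isW_add h (isW_neg h')
  have isW_zero : IsW 0 0 := fun τ ↦ by simp
  -- (KILL) a class with a witness point in `N = E(K_∞·K_v) + ι(E[p^∞])` is killed by `χ`
  have hkill : ∀ (c : S)
      (φ : contOneCocycles (discreteTopRep κ.kerSubgroup (W.geomPrimaryTorsion p))) (Q : localPoints W E),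
      oneCocycleClass _ φ = (c : W.subgroupH1 p κ.kerSubgroup) → IsW φ Q → Q ∈ N → χ c = 0 := by
    intro c φ Q hφ hW hQN
    obtain ⟨e, he, u, hu, heu⟩ := AddSubgroup.mem_sup.1 hQN
    obtain ⟨t, ht, rfl⟩ := AddSubgroup.mem_map.1 hu
    refine hχ c φ ⟨t, ht⟩ hφ fun τ ↦ ?_
    have hfix : (τ : Field.absoluteGaloisGroup E) • e = e := (mem_localTowerPointsOfEmb_iff κ ι W e).1 he τ τ.2
    rw [hW τ, ← heu, smul_add, hfix]
    abel
  -- the subgroup of witness points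
  let Wit : AddSubgroup (localPoints W E) :=
    { carrier := {Q | ∃ (φ : contOneCocycles (discreteTopRep κ.kerSubgroup (W.geomPrimaryTorsion p))) (k : ℕ),
        p ^ k • Q ∈ A ∧ IsW φ Q ∧ oneCocycleClass _ φ ∈ S}
      zero_mem' := ⟨0, 0, by rw [smul_zero]; exact zero_mem A, isW_zero, by rw [oneCocycleClass_zero]; exact zero_mem S⟩
      add_mem' := by
        rintro Q Q' ⟨φ, k, hQ, hW, hS⟩ ⟨φ', k', hQ', hW', hS'⟩
        refine ⟨φ + φ', k + k', ?_, isW_add hW hW', by rw [oneCocycleClass_add]; exact add_mem hS hS'⟩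
        rw [smul_add]
        refine add_mem ?_ ?_
        · rw [pow_add, mul_comm, mul_smul]; exact AddSubgroup.nsmul_mem A hQ _
        · rw [pow_add, mul_smul]; exact AddSubgroup.nsmul_mem A hQ' _
      neg_mem' := by
        rintro Q ⟨φ, k, hQ, hW, hS⟩
        refine ⟨-φ, k, by rw [smul_neg]; exact neg_mem hQ, isW_neg hW, ?_⟩
        rw [← oneCocycleClassₗ_apply, map_neg, oneCocycleClassₗ_apply]; exact neg_mem hS }
  -- chosen witnesses of witness points, and the descended character `Φ`
  have hWit : ∀ Q : Wit, ∃ (φ : contOneCocycles (discreteTopRep κ.kerSubgroup (W.geomPrimaryTorsion p))) (k : ℕ),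
      p ^ k • (Q : localPoints W E) ∈ A ∧ IsW φ Q ∧ oneCocycleClass _ φ ∈ S := fun Q ↦ Q.2
  choose φW kW hAW hWW hSW using hWit
  let cW : Wit → S := fun Q ↦ ⟨oneCocycleClass _ (φW Q), hSW Q⟩
  -- two witnessed classes with witness points congruent mod `N` have the same `χ`
  have hcongr : ∀ (c c' : S)
      (φ φ' : contOneCocycles (discreteTopRep κ.kerSubgroup (W.geomPrimaryTorsion p))) (Q Q' : localPoints W E),
      oneCocycleClass _ φ = (c : W.subgroupH1 p κ.kerSubgroup) → oneCocycleClass _ φ' = (c' : W.subgroupH1 p κ.kerSubgroup) →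
      IsW φ Q → IsW φ' Q' → Q - Q' ∈ N → χ c = χ c' := by
    intro c c' φ φ' Q Q' hφ hφ' hW hW' hQQ'
    rw [← sub_eq_zero, ← map_sub]
    refine hkill (c - c') (φ - φ') (Q - Q') ?_ (isW_sub hW hW') hQQ'
    rw [oneCocycleClass_sub, hφ, hφ']; rfl
  let Φ : Wit →+ AddCircle (1 : ℚ) :=
    { toFun := fun Q ↦ χ (cW Q)
      map_zero' := by
        have h0N : ((0 : Wit) : localPoints W E) ∈ N := by rw [ZeroMemClass.coe_zero]; exact zero_mem N
        exact hkill (cW 0) (φW 0) _ rfl (hWW 0) h0N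
      map_add' := fun Q Q' ↦ by
        change χ (cW (Q + Q')) = χ (cW Q) + χ (cW Q')
        rw [← map_add]
        refine hcongr (cW (Q + Q')) (cW Q + cW Q') (φW (Q + Q')) (φW Q + φW Q') _ _ rfl ?_ (hWW _)
          (isW_add (hWW Q) (hWW Q')) ?_
        · rw [oneCocycleClass_add]; rfl
        · rw [AddSubgroup.coe_add, sub_self]; exact zero_mem N }
  have hΦ : ∀ Q : Wit, Φ Q = χ (cW Q) := fun Q ↦ rfl
  -- `Φ` vanishes on `Wit ∩ N`
  have hΦN : ∀ Q : Wit, (Q : localPoints W E) ∈ N → Φ Q = 0 := fun Q hQN ↦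
    hkill (cW Q) (φW Q) Q rfl (hWW Q) hQN
  -- extension to `Wit ⊔ N` (zero on `N`) …
  let WitS : Submodule ℤ (localPoints W E) := Wit.toIntSubmodule
  let NS : Submodule ℤ (localPoints W E) := N.toIntSubmodule
  let f₁ : localPoints W E →ₗ.[ℤ] AddCircle (1 : ℚ) := ⟨WitS, Φ.toIntLinearMap⟩
  let f₂ : localPoints W E →ₗ.[ℤ] AddCircle (1 : ℚ) := ⟨NS, 0⟩
  have Hagree : ∀ (x : f₁.domain) (y : f₂.domain), (x : localPoints W E) = y → f₁ x = f₂ y := by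
    intro x y hxy
    change Φ x = (0 : NS →ₗ[ℤ] AddCircle (1 : ℚ)) y
    rw [LinearMap.zero_apply]
    exact hΦN x (by rw [hxy]; exact y.2)
  let f := f₁.sup f₂ Hagree
  -- … and to all of `E(K̄_v)` by the injectivity of `ℚ/ℤ`
  obtain ⟨χt, hχt⟩ := CharacterModule.dual_surjective_of_injective (R := ℤ) f.domain.subtype
    (Submodule.injective_subtype _) f.toFun.toAddMonoidHom
  have hχt_apply : ∀ x : f.domain, χt (x : localPoints W E) = f x := fun x ↦ DFunLike.congr_fun hχt x
  have hχt_Wit : ∀ Q : Wit, χt (Q : localPoints W E) = χ (cW Q) := fun Q ↦ by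
    have hle := f₁.left_le_sup f₂ Hagree
    have e1 : f₁ Q = f (Submodule.inclusion hle.1 Q) := LinearPMap.apply_comp_inclusion hle Q
    rw [← hΦ, show Φ Q = f₁ Q from rfl, e1, ← hχt_apply]
    rfl
  have hχt_N : ∀ u : localPoints W E, u ∈ N → χt u = 0 := fun u hu ↦ by
    have hle := f₁.right_le_sup f₂ Hagree
    have e1 : f₂ ⟨u, hu⟩ = f (Submodule.inclusion hle.1 ⟨u, hu⟩) := LinearPMap.apply_comp_inclusion hle ⟨u, hu⟩
    have e2 : f₂ ⟨u, hu⟩ = 0 := rfl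
    rw [show χt u = χt ((Submodule.inclusion hle.1 ⟨u, hu⟩ : f.domain) : localPoints W E) from rfl, hχt_apply, ← e1, e2]
  -- roots differ by `N`-elements, so `χt` is constant on the roots of a point
  have hroot : ∀ {k : ℕ} {Q Q' P : localPoints W E}, p ^ k • Q = P → p ^ k • Q' = P → χt Q' = χt Q := by
    intro k Q Q' P hQ hQ'
    obtain ⟨t, rfl⟩ := exists_torsion_of_pow_nsmul_eq W p ι hQ hQ'
    rw [map_add, hχt_N _ (AddSubgroup.mem_sup_right (AddSubgroup.mem_map_of_mem _ t.2)), add_zero]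
  -- chosen roots and the residues `Nk P : ℤ/p^k`
  have hdiv : ∀ (k : ℕ) (P : localPoints W E), ∃ Q : localPoints W E, p ^ k • Q = P := fun k P ↦
    W.nsmul_surjective_localPoints E (pow_ne_zero k (Fact.out : p.Prime).ne_zero) P
  choose R hR using hdiv
  have hval : ∀ (k : ℕ) (P : T), ∃ n : ZMod (p ^ k),
      χt (R k P) = n.val • ((((p : ℚ) ^ k)⁻¹ : ℚ) : AddCircle (1 : ℚ)) := fun k P ↦ by
    refine exists_zmod_val_smul_invPow_eq p k _ ?_
    rw [← map_nsmul, hR k P]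
    exact hχt_N _ (AddSubgroup.mem_sup_left P.2)
  choose Nk hNk using hval
  -- value of `χt` at ANY `p^k`-th root of a tower point
  have hNk' : ∀ (k : ℕ) (P : T) (Q : localPoints W E), p ^ k • Q = (P : localPoints W E) →
      χt Q = (Nk k P).val • ((((p : ℚ) ^ k)⁻¹ : ℚ) : AddCircle (1 : ℚ)) := fun k P Q hQ ↦ by
    rw [hroot (hR k P) hQ, hNk]
  -- compatibility `Nk (k+1) P ≡ Nk k P (mod p^k)`
  have hcompat : ∀ (P : T) (k : ℕ),
      ZMod.castHom (pow_dvd_pow p (Nat.le_succ k)) (ZMod (p ^ k)) (Nk (k + 1) P) = Nk k P := by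
    intro P k
    haveI : NeZero (p ^ k) := ⟨pow_ne_zero k (Fact.out : p.Prime).ne_zero⟩
    haveI : NeZero (p ^ (k + 1)) := ⟨pow_ne_zero (k + 1) (Fact.out : p.Prime).ne_zero⟩
    apply zmod_eq_of_val_smul_invPow_eq p
    have hx0 : p ^ k • ((((p : ℚ) ^ k)⁻¹ : ℚ) : AddCircle (1 : ℚ)) = 0 := pow_nsmul_invPow_self p k
    -- `p • R_{k+1}` is a `p^k`-th root
    have hroot' : p ^ k • (p • R (k + 1) P) = (P : localPoints W E) := by rw [smul_smul, ← pow_succ, hR]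
    rw [ZMod.castHom_apply, ZMod.cast_eq_val, ZMod.val_natCast, IwasawaDual.mod_smul_eq hx0, ← hNk' k P _ hroot',
      map_nsmul, hNk (k + 1) P, smul_smul, mul_comm, mul_smul,
      ← pow_nsmul_invPow_eq p (Nat.le_succ k), Nat.succ_sub (le_refl k), Nat.sub_self, pow_one]
  -- the functional
  have hz : ∀ P : T, ∃ x : ℤ_[p], ∀ k, PadicInt.toZModPow k x = Nk k P := fun P ↦
    exists_padicInt_toZModPow_eq p (fun k ↦ Nk k P) (hcompat P)
  choose zf hzf using hz
  have hzf_add : ∀ P P' : T, zf (P + P') = zf P + zf P' := by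
    intro P P'
    refine PadicInt.ext_of_toZModPow.1 fun k ↦ ?_
    haveI : NeZero (p ^ k) := ⟨pow_ne_zero k (Fact.out : p.Prime).ne_zero⟩
    rw [map_add, hzf, hzf, hzf]
    apply zmod_eq_of_val_smul_invPow_eq p
    have hx0 : p ^ k • ((((p : ℚ) ^ k)⁻¹ : ℚ) : AddCircle (1 : ℚ)) = 0 := pow_nsmul_invPow_self p k
    have hsum : p ^ k • (R k P + R k P') = ((P + P' : T) : localPoints W E) := by
      rw [smul_add, hR, hR, AddSubgroup.coe_add]
    rw [← hNk' k (P + P') _ hsum, map_add, hNk' k P _ (hR k P), hNk' k P' _ (hR k P'), ZMod.val_add,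
      IwasawaDual.mod_smul_eq hx0, add_smul]
  refine ⟨{ toFun := zf, map_zero' := ?_, map_add' := hzf_add }, fun c φ Q k hφ hQ hW ↦ ?_⟩
  · have h := hzf_add 0 0
    rwa [add_zero, left_eq_add] at h
  · -- the value formula
    change χ c = (PadicInt.toZModPow k (zf ⟨p ^ k • Q, hA hQ⟩)).val • _
    rw [hzf, ← hNk' k ⟨p ^ k • Q, hA hQ⟩ Q rfl]
    have hQW : Q ∈ Wit := ⟨φ, k, hQ, hW, by rw [hφ]; exact c.2⟩
    rw [show χt Q = χt ((⟨Q, hQW⟩ : Wit) : localPoints W E) from rfl, hχt_Wit ⟨Q, hQW⟩]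
    exact hcongr c (cW ⟨Q, hQW⟩) φ (φW ⟨Q, hQW⟩) Q Q hφ rfl hW (hWW ⟨Q, hQW⟩) (by rw [sub_self]; exact zero_mem N)

end Functional

end SignedKatoOffTwo.KummerPoint

end Summit.BirchSwinnertonDyer.BirchSwinnertonDyer.Theorems

end
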